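import Literature.AlgebraicGeometry.Frobenioids.KummerInflationTwo
import Literature.AlgebraicGeometry.Frobenioids.PadicKummerRemark221
import Literature.NumberTheory.GaloisRepresentations.ProfiniteIntersectionCocycleExtension
import HarnessLib

/-!
# Frobenioids II, Remark 2.2.1: `(N, H)`-saturated pull-backs exist (the arithmetic binding)

Mochizuki, *The geometry of Frobenioids II*, Kyushu J. Math. **62** (2008) 401–460, §2, Definition
2.2 (ii) pp. 17–18 and Remark 2.2.1 p. 18 [cite: MochizukiFrdII2008, Rmk 2.2.1 p.18]: "Thus, it
follows immediately from the definitions, together with the finiteness of the cohomology modules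
`H¹(H, μ_N(A))`, `H²(H, μ_N(A))` [cf., e.g., [NSW], Chapter 7, Theorem 7.2.6], that given an
`A′ ∈ Ob(C)`, … for any `N`, `H` as in Definition 2.2, there exists a pull-back morphism
`A″ → A′` in `C` such that `A″` is `(N, H)`-saturated."

`PadicKummerSetting.lean` (abc-iut-L1-t7) records this as the NAMED FACT
`PadicKummer.ExistsSaturatedPullback Obj OpenNormal HasPullbackMorphismTo ctx` (a schema over a
family of Definition 2.2 contexts). This PROOF-ONLY file DISCHARGES it at the arithmetic binding
`Def22Context.ofLocalField` (`PadicKummerLocalField.lean`: `K` a non-archimedean local field of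
characteristic `0`, `A_E = Spec L` for `L ⊆ K̄` finite Galois, `H ⊆ G_K` open normal,
`O^□(A) = O^□_L`, `Ker(H ↠ H_A) = H ∩ Gal(K̄/L)`), by the printed argument made explicit.

§1 (any context `X`). `oneCocycles_vanish_of_iso`, `infl_two_surjective_of_iso`: the `H¹`- and
`H²`-clauses of Definition 2.2 (ii)(c), in the "extension-field-theoretic" form of
`Def22Context.isNHSaturated_iff_oneCocycles` (`KummerInflationRange.lean`), TRANSPORTED along an
isomorphism of topological `H`-modules to any model `T`: they hold as soon as all continuous
crossed homomorphisms `H → T` vanish on (resp. all classes of `H²(H, T)` have representative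
`2`-cocycles constant, in each variable, on the cosets of) a set `P ⊇ Ker(H ↠ H_A)` (degree two by
descent along `H ↠ H_A`, `KummerInflationTwo.lean`).

§2 (the Galois binding `X = ofGalois L H …`, `m : MuModel L O N`). The two models that do NOT
depend on `L`: `μ_N(K̄)|_H` (the tree's `DiscreteGaloisModule.mu K N` restricted to `H`,
identified with `μ_N(A)` by abc-iut-L1-t7's `muCoeffIso`) and `ℤ/Nℤ` with the trivial action
(`nonempty_trivCoeffIso_ofGalois`); `qHA_ofGalois_eq_one_iff` (`Ker(H ↠ H_A) = H ∩ Gal(K̄/L)`);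
`isNHSaturated_ofGalois_of_model` — `A` is `(N, H)`-saturated as soon as (a) `μ_N(A) ≅ ℤ/Nℤ`,
(b) `L/K` Galois, (c₁) every continuous crossed homomorphism `H → μ_N(K̄)` and (c₂) every
continuous homomorphism `H → ℤ/Nℤ` vanish on `H ∩ Gal(K̄/L)`, (c₃) every class of
`H²(H, μ_N(K̄))` has a representative `2`-cocycle constant on `H ∩ Gal(K̄/L)`-cosets.

§3 (existence). `exists_isNHSaturated_ofLocalField` — **for every finite `L′ ⊆ K̄`, `N ≥ 1` and
open normal `H ⊆ G_K` there is a finite Galois `L″ ⊇ L′` with `A″ = (L″, O^□_{L″})`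
`(N, H)`-saturated** (every `Gal(L″/K)`-stable `O^□_{L″}` containing the `N`-th roots of unity of
`L″`): by the finiteness of `H¹(H, μ_N(K̄))`, `H¹(H, ℤ/Nℤ)` (the tree's
`finite_continuousCohomology_one_restrict`, Serre II §5.2 Prop. 14) and of `H²(H, μ_N(K̄))`
(`finite_two_mu`, *Corps locaux* XIII §3) choose finitely many representative cocycles; each
crossed homomorphism vanishes on an open neighbourhood of `1`, each `2`-cocycle is adapted to an
open normal subgroup of `G_K` acting trivially on `μ_N(K̄)` (the tree's
`exists_openNormalSubgroup_adapted`, Serre I §2.2 Prop. 8); a finite Galois `L″` with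
`Gal(K̄/L″)` inside all of these, the stabilisers of `μ_N(K̄)` and `Gal(K̄/L′)` (Krull topology,
`exists_finiteDimensional_isGalois_galFixing_subset`) contains `L′`, `μ_N(K̄)` and satisfies
(a)–(c₃). `existsSaturatedPullback_ofLocalField` — **`ExistsSaturatedPullback` DISCHARGED** for
the family `(L, H) ↦ ofLocalField L H (O^□_L)` over the finite normal `L ⊆ K̄` (the objects with
`A_D` Galois; every object is dominated by one via the normal closure) and
`OpenNormalSubgroup G_K`, "`A″ → A′` is a pull-back morphism" read on bases as `L′ ⊆ L″`
(the Frobenioid-level morphism is abc-iut-L1-t4's binding, [FrdII] Ex. 1.1).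
No definitions; nothing here concerns [IUTchIII]; classical local Galois cohomology. Universe `0`.
-/

noncomputable section

namespace Literature.AlgebraicGeometry.Frobenioids

namespace PadicKummer

open Field IntermediateField CategoryTheory Topology Filter
open Literature.NumberTheory.GaloisRepresentations
open Literature.NumberTheory.GaloisRepresentations.LocalWeilDatum
open Literature.NumberTheory.GaloisRepresentations.DiscreteGaloisModule

namespace Def22Context
/-! ### Transport of the clauses of (c) along an isomorphism of coefficient modules (any `X`) -/

section Abstract

variable (X : Def22Context) (N : ℕ)

/-- **Transport of the `H¹`-clauses.** For any context `X`, any coefficient `H_A`-module `M`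
(in Definition 2.2: `μ_N(A)` or `ℤ/Nℤ`) and any topological `H`-module `T` isomorphic to `M|_H`
(restriction along `H ↠ H_A`): if every continuous crossed homomorphism `H → T` vanishes on a set
`P ⊇ Ker(H ↠ H_A)`, then every continuous crossed homomorphism `H → M` vanishes on
`Ker(H ↠ H_A)`. [cite: MochizukiFrdII2008, Def 2.2 (ii) p.17] -/
theorem oneCocycles_vanish_of_iso (M : TopRep.{0} ℤ X.HA) {T : TopRep.{0} ℤ X.H}
    (e : TopRep.res (X.qHA : X.H →* X.HA) M ≅ T) (P : X.H → Prop)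
    (hP : ∀ k : X.H, X.qHA k = 1 → P k) (h : ∀ c : contOneCocycles T, ∀ σ, P σ → c.1 σ = 0) :
    ∀ c : contOneCocycles (TopRep.res (X.qHA : X.H →* X.HA) M), ∀ σ, X.qHA σ = 1 → c.1 σ = 0 := by
  intro c σ hσ
  let cB := contOneCocycles.pullback (ContinuousMonoidHom.id _) (resIdHom e.hom) c
  have h0 : cB.1 σ = 0 := h cB σ (hP σ hσ)
  rw [contOneCocycles.pullback_apply, resIdHom_hom_apply] at h0
  have hinj : Function.Injective e.hom.hom := fun a b hab => by
    have := congrArg e.inv.hom hab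
    rwa [← TopRep.comp_apply, ← TopRep.comp_apply, e.hom_inv_id, TopRep.id_apply,
      TopRep.id_apply] at this
  exact hinj (h0.trans (map_zero e.hom.hom).symm)

/-- **Transport of the `H²`-clause.** For any context `X` with `H` locally compact and any
topological `H`-module `T` isomorphic to `μ_N(A)|_H`: if every class of `H²(H, T)` has a
representative continuous `2`-cocycle constant, in each variable, on the cosets of a set
`P ⊇ Ker(H ↠ H_A)`, then `H²(H_A, μ_N(A)) → H²(H, μ_N(A))` is surjective (transport along the
isomorphism, then descent along `H ↠ H_A`, `KummerInflationTwo`).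
[cite: MochizukiFrdII2008, Def 2.2 (ii) p.17] -/
theorem infl_two_surjective_of_iso [LocallyCompactSpace X.H] {T : TopRep.{0} ℤ X.H}
    (e : TopRep.res (X.qHA : X.H →* X.HA) (Kummer.muTopRep N X.O X.HA) ≅ T) (P : X.H → Prop)
    (hP : ∀ k : X.H, X.qHA k = 1 → P k)
    (h : ∀ y : continuousCohomology 2 T, ∃ c : contTwoCocycles T, twoCocycleClass _ c = y ∧
        (∀ σ τ k : X.H, P k → c.1 (σ * k, τ) = c.1 (σ, τ)) ∧
        (∀ σ τ k : X.H, P k → c.1 (σ, τ * k) = c.1 (σ, τ))) :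
    Function.Surjective (Kummer.infl X.HA X.qHA (Kummer.muTopRep N X.O X.HA) 2).hom := by
  refine infl_two_surjective_of_forall_exists X N fun y => ?_
  obtain ⟨c, hc, hc₁, hc₂⟩ := h ((cohomologyMap e.hom 2).hom y)
  refine ⟨contTwoCocycles.pullback (ContinuousMonoidHom.id _) (resIdHom e.inv) c, ?_, ?_, ?_⟩
  · rw [← cohomologyMap_twoCocycleClass e.inv c, hc]
    exact cohomologyMap_inv_hom_apply e 2 y
  · intro σ τ k hk
    rw [pullback₂_id_resIdHom_apply, pullback₂_id_resIdHom_apply, hc₁ σ τ k (hP k hk)]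
  · intro σ τ k hk
    rw [pullback₂_id_resIdHom_apply, pullback₂_id_resIdHom_apply, hc₂ σ τ k (hP k hk)]

end Abstract

/-! ### The Galois binding: `Ker(H ↠ H_A) = H ∩ Gal(K̄/L)` and the two coefficient models -/

section Galois

variable {K : Type} [Field K] (L : IntermediateField K (AlgebraicClosure K)) [Normal K L]
  [FiniteDimensional K L]
  (H : Subgroup (absoluteGaloisGroup K)) [H.Normal] (hH : IsOpen (H : Set (absoluteGaloisGroup K)))
  {AutC : Type} (O : Type) [Group AutC] [CommMonoid O] [IsCancelMul O] [MulDistribMulAction AutC O]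
  [MulDistribMulAction (L ≃ₐ[K] L) O] (res : AutC →* (L ≃ₐ[K] L))
  (res_smul : ∀ (α : AutC) (x : O), res α • x = α • x) {N : ℕ}

/-- `σ ∈ H` lies in `Ker(H ↠ H_A)` iff `σ ∈ Gal(K̄/L)` (restatement of
`mem_ker_toHA_ofGalois_iff` for the continuous surjection `qHA`).
[cite: MochizukiFrdII2008, Def 2.2 (i) p.17] -/
theorem qHA_ofGalois_eq_one_iff (σ : (ofGalois L H hH res res_smul).H) :
    (ofGalois L H hH res res_smul).qHA σ = 1 ↔
      (σ : absoluteGaloisGroup K) ∈ galFixing K L := by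
  rw [← mem_ker_toHA_ofGalois_iff L H hH res res_smul σ, MonoidHom.mem_ker]
  exact Iff.rfl

/-- The coefficient module `ℤ/Nℤ` of the second `H¹`-clause of Definition 2.2 (ii)(c)
(`Kummer.trivTopRep`, trivial action through `H ↠ H_A`) is, as a topological `H`-module, the
trivial module `ℤ/Nℤ` of `G_K` restricted to `H` (identity map) — a model which does not
depend on `L`. [cite: MochizukiFrdII2008, Def 2.2 (ii) p.17] -/
theorem nonempty_trivCoeffIso_ofGalois (N : ℕ) :
    Nonempty (TopRep.res ((ofGalois L H hH res res_smul).qHA :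
        (ofGalois L H hH res res_smul).H →* (ofGalois L H hH res res_smul).HA)
      (Kummer.trivTopRep N (ofGalois L H hH res res_smul).HA) ≅
      ((ContinuousRep.trivial (absoluteGaloisGroup K) ℤ (ZMod N)).restrict
        (subgroupIncl H)).toTopRep) :=
  ⟨topRepIsoOfEquiv (ContinuousLinearEquiv.refl ℤ (ZMod N)) fun _ _ => rfl⟩

variable [CharZero K] [IsClosed (H : Set (absoluteGaloisGroup K))]

attribute [local instance] compactSpace_of_isClosed_subgroup

/-- **Definition 2.2 (ii) at the Galois binding, from the `L`-independent models**
(`K` of characteristic `0`, `H ⊆ G_K` open — hence closed — normal, `m : μ_N(A) ≅ μ_N(K̄)`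
`G_K`-equivariantly): `A` is `(N, H)`-saturated as soon as (a) `μ_N(A) ≅ ℤ/Nℤ`, (b) `L/K` is
Galois, (c₁) every continuous crossed homomorphism `H → μ_N(K̄)` and (c₂) every continuous
homomorphism `H → ℤ/Nℤ` vanish on `H ∩ Gal(K̄/L)`, and (c₃) every class of `H²(H, μ_N(K̄))`
has a representative continuous `2`-cocycle constant on `H ∩ Gal(K̄/L)`-cosets in each variable.
(The clauses (c₁)–(c₃) are those of `isNHSaturated_iff_oneCocycles`, transported along
`muCoeffIso` / `nonempty_trivCoeffIso_ofGalois`.) [cite: MochizukiFrdII2008, Def 2.2 (ii) p.17] -/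
theorem isNHSaturated_ofGalois_of_model (m : MuModel L O N)
    (ha : Kummer.IsMuSaturated N O) (hb : IsGalois K L)
    (h₁ : ∀ c : contOneCocycles ((mu K N).restrict (subgroupIncl H)).toTopRep, ∀ σ : H,
      (σ : absoluteGaloisGroup K) ∈ galFixing K L → c.1 σ = 0)
    (h₂ : ∀ c : contOneCocycles ((ContinuousRep.trivial (absoluteGaloisGroup K) ℤ (ZMod N)).restrict
        (subgroupIncl H)).toTopRep, ∀ σ : H,
      (σ : absoluteGaloisGroup K) ∈ galFixing K L → c.1 σ = 0)
    (h₃ : ∀ y : continuousCohomology 2 ((mu K N).restrict (subgroupIncl H)).toTopRep,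
      ∃ c : contTwoCocycles ((mu K N).restrict (subgroupIncl H)).toTopRep,
        twoCocycleClass _ c = y ∧
        (∀ σ τ k : H, (k : absoluteGaloisGroup K) ∈ galFixing K L → c.1 (σ * k, τ) = c.1 (σ, τ)) ∧
        (∀ σ τ k : H, (k : absoluteGaloisGroup K) ∈ galFixing K L →
          c.1 (σ, τ * k) = c.1 (σ, τ))) :
    IsNHSaturated (ofGalois L H hH res res_smul) N := by
  rw [isNHSaturated_iff_oneCocycles]
  obtain ⟨e₀⟩ := nonempty_trivCoeffIso_ofGalois L H hH O res res_smul N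
  haveI : LocallyCompactSpace (ofGalois L H hH res res_smul).H :=
    inferInstanceAs (LocallyCompactSpace H)
  exact ⟨ha, hb,
    oneCocycles_vanish_of_iso (ofGalois L H hH res res_smul) _ (muCoeffIso L O H hH res res_smul m)
      (fun k => (k : absoluteGaloisGroup K) ∈ galFixing K L)
      (fun k hk => (qHA_ofGalois_eq_one_iff L H hH O res res_smul k).mp hk) h₁,
    oneCocycles_vanish_of_iso (ofGalois L H hH res res_smul) _ e₀
      (fun k => (k : absoluteGaloisGroup K) ∈ galFixing K L)
      (fun k hk => (qHA_ofGalois_eq_one_iff L H hH O res res_smul k).mp hk) h₂,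
    infl_two_surjective_of_iso (ofGalois L H hH res res_smul) N (muCoeffIso L O H hH res res_smul m)
      (fun k => (k : absoluteGaloisGroup K) ∈ galFixing K L)
      (fun k hk => (qHA_ofGalois_eq_one_iff L H hH O res res_smul k).mp hk) h₃⟩

end Galois

/-! ### Remark 2.2.1: existence of saturated pull-backs -/

section Existence

variable {K : Type} [Field K] [ValuativeRel K] [TopologicalSpace K] [IsNonarchimedeanLocalField K]
  [CharZero K]

attribute [local instance] compactSpace_of_isClosed_subgroup

/-- **Remark 2.2.1, existence of `(N, H)`-saturated pull-backs, at the arithmetic binding**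
(FrdII p. 18): for `K` a non-archimedean local field of characteristic `0`, every finite
`L′ ⊆ K̄`, every `N ≥ 1` and every open normal subgroup `H ⊆ G_K`, there is a finite Galois
extension `L″ ⊇ L′` of `K` inside `K̄` such that the context `ofLocalField L″ H hH S` is
`(N, H)`-saturated for every `Gal(L″/K)`-stable submonoid `S = O^□_{L″} ⊆ L″` containing the
`N`-th roots of unity of `L″` ("it follows immediately from the definitions, together with the
finiteness of the cohomology modules `H¹(H, μ_N(A))`, `H²(H, μ_N(A))`").
[cite: MochizukiFrdII2008, Rmk 2.2.1 p.18] -/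
theorem exists_isNHSaturated_ofLocalField (L' : IntermediateField K (AlgebraicClosure K))
    [FiniteDimensional K L'] (H : Subgroup (absoluteGaloisGroup K)) [H.Normal]
    (hH : IsOpen (H : Set (absoluteGaloisGroup K))) (N : ℕ) [NeZero N] :
    ∃ L : IntermediateField K (AlgebraicClosure K), ∃ (_ : FiniteDimensional K L)
      (_ : IsGalois K L), L' ≤ L ∧ ∀ S : StableSubmonoid L,
        (∀ x : L, x ^ N = 1 → x ∈ S.toSubmonoid) → IsNHSaturated (ofLocalField L H hH S) N := by
  classical
  haveI : IsClosed (H : Set (absoluteGaloisGroup K)) := H.isClosed_of_isOpen hH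
  haveI : Finite (absoluteGaloisGroup K ⧸ H) := Subgroup.quotient_finite_of_isOpen H hH
  haveI : Finite (MuCarrier K N) := finite_muCarrier K N
  -- the two `L`-independent models `μ_N(K̄)|_H` and `ℤ/Nℤ`
  set T : TopRep ℤ H := ((mu K N).restrict (subgroupIncl H)).toTopRep with hT
  set T₀ : TopRep ℤ H := ((ContinuousRep.trivial (absoluteGaloisGroup K) ℤ (ZMod N)).restrict
    (subgroupIncl H)).toTopRep with hT₀
  -- finiteness of `H¹(H, μ_N)`, `H¹(H, ℤ/N)`, `H²(H, μ_N)` (Remark 2.2.1's input, NSW 7.2.6)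
  haveI : Finite (continuousCohomology 1 T) := finite_continuousCohomology_one_restrict K H (mu K N)
  haveI : Finite (continuousCohomology 1 T₀) :=
    finite_continuousCohomology_one_restrict K H
      (ContinuousRep.trivial (absoluteGaloisGroup K) ℤ (ZMod N))
  haveI : Finite (continuousCohomology 2 T) := by
    obtain ⟨E₀, hfin, _, hE⟩ := exists_galFixing_eq H hH
    subst hE
    haveI := hfin
    exact finite_two_mu K E₀ N
  -- representative cocycles, and for `H²` an adapted open normal subgroup for each
  have h2 : ∀ y : continuousCohomology 2 T, ∃ c : contTwoCocycles T,
      ∃ W : OpenNormalSubgroup (absoluteGaloisGroup K),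
        twoCocycleClass T c = y ∧ IsAdapted (mu K N) H W c := fun y => by
    obtain ⟨c, rfl⟩ := twoCocycleClass_surjective T y
    obtain ⟨W, hW⟩ := exists_openNormalSubgroup_adapted (mu K N) H c
    exact ⟨c, W, rfl, hW⟩
  choose c₂ W₂ hc₂ hW₂ using h2
  choose ψ₁ hψ₁ using oneCocycleClass_surjective T
  choose ψ₀ hψ₀ using oneCocycleClass_surjective T₀
  -- the neighbourhood of `1` in `G_K` to be dominated by `Gal(K̄/L″)`
  set S₁ : Set (absoluteGaloisGroup K) :=
    ⋂ y, (((W₂ y : OpenNormalSubgroup (absoluteGaloisGroup K)) : Subgroup (absoluteGaloisGroup K)) :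
      Set (absoluteGaloisGroup K)) with hS₁
  set S₂ : Set (absoluteGaloisGroup K) := ⋂ x, Subtype.val '' ((ψ₁ x).1 ⁻¹' {0}) with hS₂
  set S₃ : Set (absoluteGaloisGroup K) := ⋂ x, Subtype.val '' ((ψ₀ x).1 ⁻¹' {0}) with hS₃
  set S₄ : Set (absoluteGaloisGroup K) := ⋂ a : MuCarrier K N, {g | mu K N g a = a} with hS₄
  set V : Set (absoluteGaloisGroup K) :=
    S₁ ∩ S₂ ∩ S₃ ∩ S₄ ∩ (galFixing K L' : Set (absoluteGaloisGroup K)) with hV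
  have hV1 : V ∈ 𝓝 (1 : absoluteGaloisGroup K) := by
    refine inter_mem (inter_mem (inter_mem (inter_mem ?_ ?_) ?_) ?_) ?_
    · exact (Filter.iInter_mem).2 fun y => (W₂ y).toOpenSubgroup.isOpen.mem_nhds (one_mem _)
    · refine (Filter.iInter_mem).2 fun x => IsOpen.mem_nhds ?_ ⟨1, contOneCocycles.apply_one _, rfl⟩
      exact hH.isOpenMap_subtype_val _ ((isOpen_discrete _).preimage (ψ₁ x).1.continuous)
    · refine (Filter.iInter_mem).2 fun x => IsOpen.mem_nhds ?_ ⟨1, contOneCocycles.apply_one _, rfl⟩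
      exact hH.isOpenMap_subtype_val _ ((isOpen_discrete _).preimage (ψ₀ x).1.continuous)
    · exact (Filter.iInter_mem).2 fun a => (mu K N).setOf_apply_eq_mem_nhds_one a
    · exact (isOpen_galFixing K L').mem_nhds (one_mem _)
  -- a finite Galois `L″` with `Gal(K̄/L″) ⊆ V`
  obtain ⟨L, hLfin, hLgal, hLV⟩ := exists_finiteDimensional_isGalois_galFixing_subset hV1
  haveI := hLfin
  haveI := hLgal
  -- unpacking membership in `V`
  have hW : ∀ {g : absoluteGaloisGroup K}, g ∈ galFixing K L → ∀ y,
      g ∈ ((W₂ y : OpenNormalSubgroup (absoluteGaloisGroup K)) : Subgroup (absoluteGaloisGroup K)) :=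
    fun hg y => Set.mem_iInter.1 (hLV hg).1.1.1.1 y
  have hψ₁0 : ∀ {σ : H}, (σ : absoluteGaloisGroup K) ∈ galFixing K L → ∀ x, (ψ₁ x).1 σ = 0 := by
    intro σ hσ x
    obtain ⟨σ', hσ', hval⟩ := Set.mem_iInter.1 (hLV hσ).1.1.1.2 x
    rw [← Subtype.ext hval]
    exact hσ'
  have hψ₀0 : ∀ {σ : H}, (σ : absoluteGaloisGroup K) ∈ galFixing K L → ∀ x, (ψ₀ x).1 σ = 0 := by
    intro σ hσ x
    obtain ⟨σ', hσ', hval⟩ := Set.mem_iInter.1 (hLV hσ).1.1.2 x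
    rw [← Subtype.ext hval]
    exact hσ'
  have hfix : ∀ {g : absoluteGaloisGroup K}, g ∈ galFixing K L → ∀ a : MuCarrier K N,
      mu K N g a = a := fun hg a => Set.mem_iInter.1 (hLV hg).1.2 a
  have hL' : ∀ {g : absoluteGaloisGroup K}, g ∈ galFixing K L → g ∈ galFixing K L' :=
    fun hg => (hLV hg).2
  refine ⟨L, hLfin, hLgal, ?_, fun S hS => ?_⟩
  · -- `L′ ⊆ L″`: `Gal(K̄/L″) ⊆ Gal(K̄/L′)` and the Galois correspondence for `K̄/K`
    intro x hx
    exact mem_of_forall_galFixing_smul_eq L fun σ hσ => (mem_galFixing_iff K).mp (hL' hσ) x hx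
  · -- `μ_N(K̄) ⊆ L″`
    have hμ : ∀ ζ : rootsOfUnity N (AlgebraicClosure K),
        ((ζ : (AlgebraicClosure K)ˣ) : AlgebraicClosure K) ∈ L := fun ζ => by
      refine mem_of_forall_galFixing_smul_eq L fun σ hσ => ?_
      have h := congrArg (fun v => ((muVal K N v : (AlgebraicClosure K)ˣ) : AlgebraicClosure K))
        (hfix hσ (MuCarrier.ofRootsOfUnity ζ))
      simpa only [muVal_apply, muVal_ofRootsOfUnity, Units.coe_smul] using h
    -- the criteria of `PadicKummerSaturationCriteria`
    refine isNHSaturated_ofGalois_of_model L H hH (GalMonoid S) (MonoidHom.id _) (fun _ _ => rfl)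
      (muModelOfSubmonoid L S N hS (NeZero.pos N) hμ) (isMuSaturated_galMonoid L S N hS hμ) hLgal
      ?_ ?_ ?_
    · -- (c₁): `c = ψ₁ [c] + (σ ↦ σ v - v)`, both vanishing on `Gal(K̄/L″) ∩ H`
      intro c σ hσ
      have h0 : oneCocycleClass T (c - ψ₁ (oneCocycleClass T c)) = 0 := by
        rw [oneCocycleClass_sub, hψ₁, sub_self]
      obtain ⟨v, hv⟩ := (oneCocycleClass_eq_zero_iff T _).mp h0
      have h1 := hv σ
      rw [Submodule.coe_sub, ContinuousMap.sub_apply, hψ₁0 hσ, sub_zero] at h1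
      rw [h1]
      change mu K N (σ : absoluteGaloisGroup K) v - v = 0
      rw [hfix hσ, sub_self]
    · -- (c₂): for the trivial action `c = ψ₀ [c]` on the nose
      intro c σ hσ
      have h0 : oneCocycleClass T₀ (c - ψ₀ (oneCocycleClass T₀ c)) = 0 := by
        rw [oneCocycleClass_sub, hψ₀, sub_self]
      obtain ⟨v, hv⟩ := (oneCocycleClass_eq_zero_iff T₀ _).mp h0
      have h1 := hv σ
      rw [Submodule.coe_sub, ContinuousMap.sub_apply, hψ₀0 hσ, sub_zero] at h1
      rw [h1]
      exact sub_self v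
    · -- (c₃): the chosen representative is adapted to `W₂ y ⊇ Gal(K̄/L″)`
      intro y
      refine ⟨c₂ y, hc₂ y, fun σ τ k hk => ?_, fun σ τ k hk => ?_⟩
      · refine (hW₂ y).const (σ * k) τ σ τ ?_ ?_
        · rw [Subgroup.coe_mul, mul_inv_rev, inv_mul_cancel_right]
          exact Subgroup.inv_mem _ (hW hk y)
        · rw [inv_mul_cancel]
          exact Subgroup.one_mem _
      · refine (hW₂ y).const σ (τ * k) σ τ ?_ ?_
        · rw [inv_mul_cancel]
          exact Subgroup.one_mem _
        · rw [Subgroup.coe_mul, mul_inv_rev, inv_mul_cancel_right]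
          exact Subgroup.inv_mem _ (hW hk y)

end Existence

end Def22Context

/-! ### The named fact `ExistsSaturatedPullback`, discharged -/

section Discharge

variable (K : Type) [Field K] [ValuativeRel K] [TopologicalSpace K] [IsNonarchimedeanLocalField K]
  [CharZero K]

/-- **Remark 2.2.1 DISCHARGED at the arithmetic binding** (FrdII p. 18): the named fact
`PadicKummer.ExistsSaturatedPullback` (`PadicKummerSetting.lean`) HOLDS for the family of
Definition 2.2 contexts `(A, H) ↦ Def22Context.ofLocalField L_A H (O^□_{L_A})` of a
non-archimedean local field `K` of characteristic `0` — objects: the finite normal `L ⊆ K̄`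
(`A_E = Spec L`, the objects with `A_D` Galois; any object is dominated by one via the normal
closure), with `O^□ = O^⊳` or `O^×` according as `Φ` is fieldwise saturated (`fs`,
`boxStableSubmonoid`); open normal subgroups: `OpenNormalSubgroup G_K`; "there is a pull-back
morphism `A″ → A′`" read on bases as `L′ ⊆ L″`: "given an `A′ ∈ Ob(C)`, … for any `N`, `H` as in
Definition 2.2, there exists a pull-back morphism `A″ → A′` in `C` such that `A″` is
`(N, H)`-saturated." [cite: MochizukiFrdII2008, Rmk 2.2.1 p.18] -/
theorem existsSaturatedPullback_ofLocalField (fs : Prop) :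
    Literature.AlgebraicGeometry.Frobenioids.PadicKummer.ExistsSaturatedPullback
      {L : IntermediateField K (AlgebraicClosure K) // FiniteDimensional K L ∧ Normal K L}
      (OpenNormalSubgroup (absoluteGaloisGroup K))
      (fun A'' A' => A'.1 ≤ A''.1)
      (fun A H =>
        haveI := A.2.1
        haveI := A.2.2
        Def22Context.ofLocalField A.1 (H : Subgroup (absoluteGaloisGroup K))
          H.toOpenSubgroup.isOpen (boxStableSubmonoid K A.1 fs)) := by
  intro A' N H hN
  haveI : NeZero N := NeZero.of_pos hN
  haveI := A'.2.1
  obtain ⟨L, hfin, hgal, hle, hsat⟩ :=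
    Def22Context.exists_isNHSaturated_ofLocalField A'.1 (H : Subgroup (absoluteGaloisGroup K))
      H.toOpenSubgroup.isOpen N
  haveI := hgal
  exact ⟨⟨L, hfin, inferInstance⟩, hle,
    hsat _ fun x hx => mem_boxStableSubmonoid_of_pow_eq_one K L N fs hN hx⟩

end Discharge

end PadicKummer

end Literature.AlgebraicGeometry.Frobenioids

end
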